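import Summits.KontsevichZagierPeriods.KontsevichZagierPeriods.Theorems.FurushoPentagonSectorToKernelAdmissibleOfTameAlgebraic
import Literature.NumberTheory.Transcendental.SemialgebraicVolume
import Mathlib.RingTheory.MvPolynomial.Tower
import Mathlib.Algebra.MvPolynomial.Funext
import Mathlib.MeasureTheory.Measure.Restrict

/-!
# `BetaCancellation` (stmt-KontsevichZagierPeriods-13633), line `dirichlet-companion-to-pi` — helper: an a.e.-constant `ℚ`-semialgebraic function has an ALGEBRAIC value

**The arithmetic of one-move certificates (seat c15).** A `ℚ`-semialgebraic function `f` on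
`s ⊆ ℝᵐ` which is almost everywhere equal to a real constant `c` on a measurable `S ⊆ s` of
NON-ZERO Lebesgue measure has `c` ALGEBRAIC over `ℚ` (`isAlgebraic_of_ae_eq_const`).

Proof. The graph of `f` lies in the zero set of ONE non-zero polynomial `q ∈ ℚ[X₀,…,X_m]` (the tree's
`admOfTame_exists_mvPolynomial_aeval_snoc_eq_zero`, route FurushoPentagon: a `ℚ`-semialgebraic graph has
empty interior, `IsSemialgebraic.subset_interior_union`). The points `(x, c)`, `x ∈ S`, `f x = c`, lie on
the graph, so the slice `{x | q(x, c) = 0}` has non-zero measure; it is the zero set of the real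
polynomial `q(·, c)`, which therefore vanishes identically (`volume_setOf_aeval_eq_zero`): `q(x, c) = 0`
for EVERY `x ∈ ℝᵐ`. If for some rational `x` the rational polynomial `q(x, ·) ∈ ℚ[Y]` is non-zero, `c` is
a root of it — algebraic. Otherwise `q` vanishes at every rational point of `ℝᵐ⁺¹`, so `q = 0`
(`MvPolynomial.funext` over the infinite field `ℚ`), a contradiction.

Use (this seat): the catalyst mass fractions and value ratios that a ONE-MOVE change of variables
between pinned products forces into an a.e. identity `c · f = (f' ∘ ψ)|det ψ'|` between
`ℚ`-semialgebraic integrands are automatically algebraic — transcendental constants cannot hide in a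
single substitution (`…CatalystRatioAlgebraic.lean`, `…TwoPieceFibreSubstitutionAnyFractions.lean`).
No definitions; sorry-free; axioms ⊆ {propext, Classical.choice, Quot.sound}.

References: J. Bochnak, M. Coste, M.-F. Roy, *Real Algebraic Geometry* (1998), §2.1–2.2, §2.8.
-/

noncomputable section

-- `Summit.KontsevichZagierPeriods.KontsevichZagierPeriods.…` is the tree's mandated layout (single-conjunct summit).
set_option linter.dupNamespace false

namespace Summit.KontsevichZagierPeriods.KontsevichZagierPeriods.BetaCancellationLine

open MeasureTheory Set MvPolynomial
open Literature.ModelTheory.ExponentialFields (IsSemialgebraic)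
open Literature.NumberTheory.Transcendental

/-! ### Slicing a polynomial at the last variable -/

/-- The slice `q(·, c)` of `q ∈ ℚ[X₀,…,X_m]` at height `c ∈ ℝ`, a real polynomial in `m` variables,
evaluates as expected: `q(·, c)(x) = q(x, c)`. [folklore] -/
theorem aeval_sliceLast {m : ℕ} (q : MvPolynomial (Fin (m + 1)) ℚ) (c : ℝ) (x : Fin m → ℝ) :
    aeval x (aeval (Fin.snoc (α := fun _ => MvPolynomial (Fin m) ℝ) (fun i => X i) (C c)) q) =
      aeval (Fin.snoc (α := fun _ => ℝ) x c) q := by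
  have h := comp_aeval_apply ((aeval x).restrictScalars ℚ) q
    (f := Fin.snoc (α := fun _ => MvPolynomial (Fin m) ℝ) (fun i => X i) (C c))
  rw [AlgHom.restrictScalars_apply] at h
  have hfun : (fun i => (aeval x).restrictScalars ℚ
      (Fin.snoc (α := fun _ => MvPolynomial (Fin m) ℝ) (fun i => X i) (C c) i)) =
      Fin.snoc (α := fun _ => ℝ) x c := by
    funext i
    refine Fin.lastCases ?_ (fun j => ?_) i
    · simp
    · simp
  rw [h, hfun]

/-- The rational slice `q(x, ·) ∈ ℚ[Y]` of `q ∈ ℚ[X₀,…,X_m]` at a rational point `x`, evaluated at a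
real `y`, is `q(x, y)`. [folklore] -/
theorem aeval_sliceInit {m : ℕ} (q : MvPolynomial (Fin (m + 1)) ℚ) (x : Fin m → ℚ) (y : ℝ) :
    Polynomial.aeval y
        (aeval (Fin.snoc (α := fun _ => Polynomial ℚ) (fun i => Polynomial.C (x i)) Polynomial.X) q) =
      aeval (Fin.snoc (α := fun _ => ℝ) (fun i => (x i : ℝ)) y) q := by
  rw [comp_aeval_apply]
  have hfun : (fun i => Polynomial.aeval y
      (Fin.snoc (α := fun _ => Polynomial ℚ) (fun i => Polynomial.C (x i)) Polynomial.X i)) =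
      Fin.snoc (α := fun _ => ℝ) (fun i => (x i : ℝ)) y := by
    funext i
    refine Fin.lastCases ?_ (fun j => ?_) i
    · simp
    · simp
  rw [hfun]

/-! ### The lemma -/

/-- **An a.e.-constant `ℚ`-semialgebraic function has an algebraic value.** If `f` is
`ℚ`-semialgebraic on `s ⊆ ℝᵐ`, `S ⊆ s` is measurable of non-zero Lebesgue measure, and `f = c`
almost everywhere on `S`, then `c` is algebraic over `ℚ`: the graph of `f` is covered by finitely
many zero sets of non-trivial rational polynomials; a slice `{x | q(x,c) = 0}` of non-zero measure
makes the real polynomial `q(·,c)` vanish identically; then either some rational slice `q(x,·)` is a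
non-zero rational polynomial with root `c`, or `q` vanishes at all rational points, i.e. `q = 0`.
[cite: BochnakCosteRoy1998, §2.8] -/
theorem isAlgebraic_of_ae_eq_const {m : ℕ} {s S : Set (Fin m → ℝ)} {f : (Fin m → ℝ) → ℝ}
    (hf : IsSemialgebraicFunOn ℚ s f) (hS : S ⊆ s) (hSm : MeasurableSet S)
    (hvol : volume S ≠ 0) {c : ℝ} (hae : ∀ᵐ x ∂(volume.restrict S), f x = c) :
    IsAlgebraic ℚ c := by
  classical
  -- ONE non-zero rational polynomial vanishing on the graph of `f`
  obtain ⟨q, hq, hq0⟩ :=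
    Summit.KontsevichZagierPeriods.FurushoPentagon.SectorToKernel.admOfTame_exists_mvPolynomial_aeval_snoc_eq_zero
      hf
  -- its slice at height `c` contains the good part of `S`, hence is not null
  set Z : Set (Fin m → ℝ) := {x | aeval (Fin.snoc (α := fun _ => ℝ) x c) q = 0} with hZ_def
  have hgood : {x | x ∈ S ∧ f x = c} ⊆ Z := by
    intro x hx
    show aeval (Fin.snoc (α := fun _ => ℝ) x c) q = 0
    rw [← hx.2]
    exact hq0 x (hS hx.1)
  have hbad : volume {x | x ∈ S ∧ f x ≠ c} = 0 := by
    rw [ae_restrict_iff' hSm, ae_iff] at hae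
    convert hae using 2
    ext x
    simp only [mem_setOf_eq, Classical.not_imp]
  have hqvol : volume Z ≠ 0 := by
    intro h
    apply hvol
    have hsub : S ⊆ {x | x ∈ S ∧ f x = c} ∪ {x | x ∈ S ∧ f x ≠ c} := by
      intro x hx
      by_cases hfx : f x = c
      · exact Or.inl ⟨hx, hfx⟩
      · exact Or.inr ⟨hx, hfx⟩
    exact measure_mono_null hsub (measure_union_null (measure_mono_null hgood h) hbad)
  -- the slice of `q` at height `c` is a real polynomial with a non-null zero set: it vanishes
  set qc : MvPolynomial (Fin m) ℝ :=
    aeval (Fin.snoc (α := fun _ => MvPolynomial (Fin m) ℝ) (fun i => X i) (C c)) q with hqc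
  have hqc0 : qc = 0 := by
    by_contra hne
    apply hqvol
    have hmap : map (algebraMap ℝ ℝ) qc ≠ 0 := by
      rwa [Algebra.algebraMap_self, map_id]
    have h0 := volume_setOf_aeval_eq_zero (k := ℝ) qc hmap
    have hZq : Z = {x | aeval x qc = 0} := by
      ext x
      show aeval (Fin.snoc (α := fun _ => ℝ) x c) q = 0 ↔
        aeval x (aeval (Fin.snoc (α := fun _ => MvPolynomial (Fin m) ℝ) (fun i => X i) (C c)) q) = 0
      rw [aeval_sliceLast]
    rw [hZq]
    exact h0
  have hall : ∀ x : Fin m → ℝ, aeval (Fin.snoc (α := fun _ => ℝ) x c) q = 0 := fun x => by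
    rw [← aeval_sliceLast, ← hqc, hqc0, map_zero]
  -- rational slices in the last variable
  set qx : (Fin m → ℚ) → Polynomial ℚ := fun x =>
    aeval (Fin.snoc (α := fun _ => Polynomial ℚ) (fun i => Polynomial.C (x i)) Polynomial.X) q
    with hqx
  by_cases hB : ∀ x : Fin m → ℚ, qx x = 0
  · -- `q` vanishes at every rational point of `ℝᵐ⁺¹`, hence `q = 0`: contradiction
    exfalso
    apply hq
    show q = 0
    have hq00 : q = 0 := by
      apply MvPolynomial.funext
      intro v
      rw [map_zero]
      have h1 := aeval_sliceInit q (Fin.init v) ((v (Fin.last m) : ℚ) : ℝ)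
      have hBv : aeval (Fin.snoc (α := fun _ => Polynomial ℚ) (fun i => Polynomial.C (Fin.init v i))
          Polynomial.X) q = 0 := hB (Fin.init v)
      rw [hBv, map_zero] at h1
      have h2 : (Fin.snoc (α := fun _ => ℝ) (fun i => ((Fin.init v i : ℚ) : ℝ))
          ((v (Fin.last m) : ℚ) : ℝ)) = algebraMap ℚ ℝ ∘ v := by
        funext i
        refine Fin.lastCases ?_ (fun j => ?_) i
        · simp
        · simp [Fin.init]
      rw [h2, aeval_algebraMap_apply] at h1
      rw [← coe_aeval_eq_eval]
      exact (algebraMap ℚ ℝ).injective (by rw [map_zero]; exact h1.symm)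
    exact hq00
  · push Not at hB
    obtain ⟨x, hx⟩ := hB
    refine ⟨qx x, hx, ?_⟩
    rw [hqx, aeval_sliceInit]
    exact hall _

end Summit.KontsevichZagierPeriods.KontsevichZagierPeriods.BetaCancellationLine

end
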